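import Summits.HodgeConjecture.HodgeConjecture.Theorems.H413PinThetaLiftNeZero
import HarnessLib

/-!
# FLOOR-0 P4, S4b — THE `(χ)`+`(N)` ROW `hχN` OF THE S4b CLOSER FROM RALLIS' IDENTITY (26) AT THE PIN (FILE 3, level 1b)

Cell hodgecm-mathlib (D-0151), FLOOR 0, crux item H413 = stmt-HodgeConjecture-24833; P4 line `Cruxes/H413/Lines/F0_P4AdmissibleOccursInH1.lean`
(tree ED. 3.2R), stub S4b `stub_T3a_holThetaAtAdmissibleLineOfRallisAt`.  Author F0P4-p03 (g3) (FILE 3 of F0P4-p05 (g2)'s design 2026-08-31T01:58:39Z).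
`--supports stmt-HodgeConjecture-24833` (helper).  DEF-FREE: theorems over LANDED theorems; nothing is cited as a fact, no `sorry`.

THE POINT.  ★ `ThetaJunction.holThetaAtAdmissibleLine_fold` (p803540) closes S4b from ANY antecedent `R` and a producer `chiN : R → (pin binders) → hχN`,
`hχN` the `(χ)`+`(N)` row of ★ `exists_holTheta_admissibleLine_of_chiN` (p802879).  **`chiN_of_rallisAtPin`** is that producer MODULO RALLIS' IDENTITY
(26) AT THE PIN in the instantiated shape every pin consumer takes — hypothesis **`hRpin`**, universally closed over the CM field (degree `≥ 4`), the
Picard-type hermitian 3-space, the real line scalar, the compatible-splitting witness, the majorants, an additive Haar `νX`, a Haar `dh`, THE pin measure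
`(cosetCongr (cmLineTorusEquiv a))_* probHaar([U(1)])` and a finite invariant open-positive `ν` on the compact `[U(diag frameD V)]` (= F0P4-p05's FILE 2 head
`rallisInnerProductIdentity_pin_of_rankOneCont(CM)` closed over its free binders).  So the by-name fold of the line is
`holThetaAtAdmissibleLine_fold (fun hR … => chiN_of_rallisAtPin (fun … => ‹FILE 2› hR …) …)` (level 2, after the S6 letter edition).

ROAD: introduce the binders of `hχN`; the model side `sideAt …` ∕ datum `distDatumAt …` (★ `H413ThetaDistAtLine`, read-backs `rfl`); ★
`RallisTransport.exists_chiRow_and_hne_of_pin_thetaLift_ne_zero` (p798140) at the pin splitting `s := splittingOf hGR₀` with TRIVIAL splitting ratio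
(`ĉ := 1`, `κ₂ := 1`, ★ `adelicMpCont.twist_one`), the J-R multiplier `κ₁` (★ `RallisTransport.exists_kappa`; continuity ★ `continuous_etaT₀`, ★
`continuous_cmLineChar₀_of_signs`, ★ `continuous_cmLineTorusEquiv`, ★ `continuous_cmAdelicOneEquivRelNormOne_symm`), majorants ★
`hasThetaMajorants_cmPairSplitting_of_signs`, `SK := univ`; its one input — the pin theta lift `Θ^{splittingOf hGR₀}_{linePhi ⊗ Φ_f}(charCM χ₂) ≠ 0` for
the pin character `χ₂([h]) = ĉ(1 ⊗ h)⁻¹ · χ_W(h_f)` — is ★ `pin_thetaLift_charCM_ne_zero` (level 1a, `Theorems/H413PinThetaLiftNeZero`); the `(χ)` row then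
reads EXACTLY `hχN`'s finite character `(ĉ ∘ ι ∘ fin ∘ inr)⁻¹ · (lineChar a t.χ ∘ subgroupCongr⁻¹)` (★ `finPart_finAdelicToAdelic`, ★ `comp_pairEmbFin_apply_inr`).
References (conventions only; nothing of print is asserted): [Liu2021] Y. Liu, Camb. J. Math. 9 (2021), proof of Prop. 4.13 (l. 2145), App. D §D.1,
Lem. D.2; [Li1992] J.-S. Li, J. reine angew. Math. 428 (1992), Thm 2.1 (26)–(27) p. 184, p. 178, §5; [GelbartRogawski1991] S. Gelbart, J. Rogawski,
Invent. Math. 105 (1991), §3.1 Prop. 3.1.1 p. 455, Remark p. 457.  HC_CM is proved only modulo the printed citations until rung 0 closes.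
-/

set_option autoImplicit false
set_option linter.dupNamespace false

noncomputable section

open MulAction NumberField NumberField.InfinitePlace NumberField.mixedEmbedding IsDedekindDomain
open _root_.MeasureTheory _root_.MeasureTheory.Measure
open scoped SchwartzMap TensorProduct Classical Matrix ComplexConjugate NNReal
open Literature.NumberTheory.Automorphic Literature.NumberTheory.Automorphic.UnitaryGroup Literature.NumberTheory.Weil1964
open Literature.NumberTheory.Weil1964.ThetaKernelDatum Literature.NumberTheory.Li1992
open Literature.Geometry.ComplexHyperbolic.BallModel (U21 x₀)
open Literature.AlgebraicGeometry.ShimuraVarieties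
open Literature.AlgebraicGeometry.Motives (CMType)
open Literature.NumberTheory.GelbartRogawski1991 Literature.NumberTheory.GelbartRogawski1991.UnitaryDualPair
open Literature.NumberTheory.GelbartRogawski1991.UnitaryDualPair.WeilCoinv (commute_comp_inl_comp_inr finPairToAdelic finPairRep)
open Literature.NumberTheory.Automorphic.Liu2021
open Literature.NumberTheory.Automorphic.Liu2021.Def411WeilCarriers (omegaAtLine rhoVAtLine Chi TW JW JW_eq isSymm_TW isUnit_det_TW lineChar locF)
open Literature.NumberTheory.Automorphic.Liu2021.Def411WeilCarriersDoubling
open Literature.NumberTheory.GaloisRepresentations (HeckeCharacter)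
open Literature.RepresentationTheory.HarrisKudlaSweet1996 (IsSplittingChar)
open Literature.RepresentationTheory.CompactGroups (charCM)
open Literature.MeasureTheory.Group
open HodgeCM HodgeCM.Adelic HodgeCM.PerL34 HodgeCM.Model HodgeCM.Model.ThetaSpace HodgeCM.Model.ArchSideTerm HodgeCM.Model.ThetaAdelicSide
open HodgeCM.Model.ThetaDistFin HodgeCM.Model.HypCensus HodgeCM.Model.LiuIndex HodgeCM.Model.TowerCarrier HodgeCM.Model.SupplyResidual
open HodgeCM.Model.SupplyResidual.WeilPairData (charInv charInv_apply)
open Literature.Analysis.SegalBargmann (binvPi)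
open Literature.AlgebraicGeometry.ShimuraVarieties (BallForms.isPullbackCocycle_cotangentCocycle BallForms.expP)
open Literature.AlgebraicGeometry.Liu2021 (IsAdmissibleElement)
open Summit.HodgeConjecture.CorCM Summit.HodgeConjecture.CorCM.Model Summit.HodgeConjecture.CorCM.Transposition
open Summit.HodgeConjecture.CorCM.Transposition.OmegaChiSplitting (hsChiD)
open Summit.HodgeConjecture.CorCM.Transposition.CentralTypeAtPin (hasCentralTypeAt_chiSplittingLine_toHeckeCharacter)
open Summit.HodgeConjecture.CorCM.Lines.A3Liu413 (datum413)
open Summit.HodgeConjecture.HodgeConjecture.Cruxes.H413.CohFormsCarriers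
open Summit.HodgeConjecture.HodgeConjecture.Cruxes.H413.CuspCot
open Summit.HodgeConjecture.HodgeConjecture.Cruxes.H413.ThetaDistAtLine
open Summit.HodgeConjecture.HodgeConjecture.Cruxes.H413.AdmissibleLine
open Summit.HodgeConjecture.HodgeConjecture.Cruxes.H413.IndexOrientation (embedding_mk_eq_of_indexOfRecord)
open Summit.HodgeConjecture.HodgeConjecture.Cruxes.H413.ThetaNonvanishing
open Summit.HodgeConjecture.HodgeConjecture.Cruxes.H413.RallisTransport

namespace Summit.HodgeConjecture.HodgeConjecture.Cruxes.H413.ThetaJunction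

/-- `U(⟨d_W⟩)(𝔸_{L⁺}) ⊂ GL₁(𝔸_L)` is commutative (`1 × 1` matrices over a commutative ring). [folklore] -/
private theorem adelic_line_mul_comm (L : Type) [Field L] [NumberField L] [IsCMField L] (dW : Fin 1 → L)
    (x y : CMAdelic L dW) : x * y = y * x := by
  apply Subtype.ext
  show (x : GL (Fin 1) (AdeleRing (𝓞 L) L)) * y = y * x
  ext i j
  simp [Units.val_mul, Matrix.mul_apply, Subsingleton.elim i 0, Subsingleton.elim j 0, mul_comm]

/-- the rational points `U(⟨d_W⟩)(L⁺)` form a NORMAL subgroup of the commutative group `U(⟨d_W⟩)(𝔸_{L⁺})`. [folklore] -/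
private theorem normal_CMRat_line (L : Type) [Field L] [NumberField L] [IsCMField L] (dW : Fin 1 → L) :
    (CMRat L dW).Normal :=
  ⟨fun m hm g => by rwa [adelic_line_mul_comm L dW g m, mul_inv_cancel_right]⟩

/-- through every complex embedding a real non-zero line scalar has ONE strict sign (the `h₁W`/`hW` rows of the majorant producer at a LINE).
[folklore] -/
private theorem re_line_sign (L : Type) [Field L] [NumberField L] [IsCMField L] (τ : L →+* ℂ) (a : L)
    (ha : IsCMField.complexConj L a = a) (ha0 : a ≠ 0) :
    (∀ j : Fin 1, 0 < (τ (lineVec L a j)).re) ∨ ∀ j : Fin 1, (τ (lineVec L a j)).re < 0 := by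
  rcases lt_or_gt_of_ne (Literature.NumberTheory.Weil1964.re_apply_ne_zero_of_complexConj_eq L τ ha ha0) with h | h
  · exact Or.inr fun _ => h
  · exact Or.inl fun _ => h

set_option synthInstance.maxHeartbeats 400000 in
set_option maxHeartbeats 8000000 in
/-- **THE `(χ)`+`(N)` ROW OF THE S4b CLOSER FROM RALLIS' IDENTITY (26) AT THE PIN.**  Hypothesis `hRpin`: for every CM field `L` of degree
`≥ 4`, every Picard-type hermitian 3-space `V`, every real non-zero line scalar `a`, every compatible-splitting witness `hGR₀` of the CM line pair
`(U(diag frameD V), U(⟨a⟩))`, all majorants `hρ` and stable index sets `SK`, every additive Haar `νX` on `𝔸_{L⁺}³`, every Haar `dh` on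
`U(⟨a⟩)(𝔸_{L⁺})`, every finite invariant open-positive `ν` on the compact `[U(diag frameD V)]`: Rallis' identity (26) for
`cmThetaKernelDatum … hGR₀ hρ SK hSK` against `⟨·,·⟩_{νX}`, `dh`, THE pin measure `(cosetCongr (cmLineTorusEquiv a))_* probHaar` and `ν` — the
conclusion of F0P4-p05's FILE 2 head `rallisInnerProductIdentity_pin_of_rankOneCont(CM)` universally closed.  Conclusion: the `chiN` binder of ★
`holThetaAtAdmissibleLine_fold` VERBATIM (tree `H413HolThetaAtAdmissibleLineFold.lean` ll. 65–164), i.e. for the H413 pin binders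
`(hDel F h6 V a₀ Φ i t hw hι e a he hae)` and the 15 inner binders `(hV ha ha0 hpos ĉ hĉ hĉV hĉW hĉc hν hνc A harm hdef)` of
★ `exists_holTheta_admissibleLine_of_chiN`: `∃ χ̃, (∀ u, D.chiFin χ̃ u = finCharZero … (1,u) · ((ĉ ∘ ι ∘ fin ∘ inr)⁻¹ · (lineChar a t.χ.1 ∘ subgroupCongr⁻¹)) u)
∧ ∃ Φ_f, D.dist (charInv χ̃) Φ_f ≠ 0`.
[cite: Liu2021, proof of Prop. 4.13 (l. 2145); App. D §D.1 Steps 1–3, Lem. D.2] [cite: Li1992, p. 178 and Thm 2.1 (26)–(27) p. 184; §5]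
[cite: GelbartRogawski1991, §3.1 Prop. 3.1.1 p. 455; Remark p. 457 L4–13] -/
theorem chiN_of_rallisAtPin
    (hRpin : ∀ (L : HodgeCM.CMField) {ι₁ : (L : Type) →+* ℂ} (V : HodgeCM.HermSpace3 L ι₁) (_h4 : 4 ≤ Module.finrank ℚ (L : Type))
      (a : (L : Type)) (ha : IsCMField.complexConj (L : Type) a = a) (ha0 : a ≠ 0)
      (hGR₀ : (cmSplittingDatum (L : Type) e₁ (frameD V) (frameD_real V) (frameD_ne V) (lineVec (L : Type) a)
        (fun _ => ha) (fun _ => ha0)).CompatibleSplitting)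
      (hρ : HasThetaMajorants fun
        (p : CMAdelic (L : Type) (frameD V) × CMAdelic (L : Type) (lineVec (L : Type) a))
        (Φ : piSchwartzBruhat (↥(maximalRealSubfield (L : Type))) (Fin 3)) =>
          cmPairRep (L : Type) e₁ (frameD V) (frameD_real V) (frameD_ne V) (lineVec (L : Type) a)
            (fun _ => ha) (fun _ => ha0) hGR₀ p Φ)
      (SK : Set (piSchwartzBruhat (↥(maximalRealSubfield (L : Type))) (Fin 3)))
      (hSK : ∀ (h : CMAdelic (L : Type) (lineVec (L : Type) a)) (Φ : piSchwartzBruhat (↥(maximalRealSubfield (L : Type))) (Fin 3)),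
        Φ ∈ SK → cmPairRep (L : Type) e₁ (frameD V) (frameD_real V) (frameD_ne V) (lineVec (L : Type) a)
          (fun _ => ha) (fun _ => ha0) hGR₀ (1, h) Φ ∈ SK)
      [MeasurableSpace (AdeleRing (𝓞 ↥(maximalRealSubfield (L : Type))) ↥(maximalRealSubfield (L : Type)))]
      [BorelSpace (AdeleRing (𝓞 ↥(maximalRealSubfield (L : Type))) ↥(maximalRealSubfield (L : Type)))]
      (νX : Measure (Fin 3 → AdeleRing (𝓞 ↥(maximalRealSubfield (L : Type))) ↥(maximalRealSubfield (L : Type)))) [νX.IsAddHaarMeasure]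
      [MeasurableSpace (CMAdelic (L : Type) (lineVec (L : Type) a))] [BorelSpace (CMAdelic (L : Type) (lineVec (L : Type) a))]
      (dh : Measure (CMAdelic (L : Type) (lineVec (L : Type) a))) [dh.IsHaarMeasure]
      [MeasurableSpace (CMAdelic (L : Type) (lineVec (L : Type) a) ⧸ CMRat (L : Type) (lineVec (L : Type) a))]
      [BorelSpace (CMAdelic (L : Type) (lineVec (L : Type) a) ⧸ CMRat (L : Type) (lineVec (L : Type) a))]
      [MeasurableSpace (CMAdelic (L : Type) (frameD V) ⧸ CMRat (L : Type) (frameD V))]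
      [BorelSpace (CMAdelic (L : Type) (frameD V) ⧸ CMRat (L : Type) (frameD V))]
      (ν : Measure (CMAdelic (L : Type) (frameD V) ⧸ CMRat (L : Type) (frameD V))) [IsFiniteMeasure ν] [ν.IsOpenPosMeasure]
      [SMulInvariantMeasure (CMAdelic (L : Type) (frameD V)) (CMAdelic (L : Type) (frameD V) ⧸ CMRat (L : Type) (frameD V)) ν]
      [CompactSpace (CMAdelic (L : Type) (frameD V) ⧸ CMRat (L : Type) (frameD V))],
      (cmThetaKernelDatum (L : Type) e₁ (frameD V) (frameD_real V) (frameD_ne V) (lineVec (L : Type) a)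
          (fun _ => ha) (fun _ => ha0) hGR₀ hρ SK hSK).RallisInnerProductIdentity
        (schwartzPairing (↥(maximalRealSubfield (L : Type))) (Fin 3) νX) dh
        ((Literature.NumberTheory.Automorphic.probHaarRelNormOneQuot (↥(maximalRealSubfield (L : Type))) (L : Type)).map
          (cosetCongr (cmLineTorusEquiv (L : Type) a ha0) (Literature.NumberTheory.Automorphic.relNormOneRat (↥(maximalRealSubfield (L : Type))) (L : Type))
            (CMRat (L : Type) (lineVec (L : Type) a)) (cmLineTorusEquiv_mem_CMRat_iff (L : Type) a ha0)))
        ν) :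
    ∀ (hDel : Literature.AlgebraicGeometry.ShimuraVarieties.UnitaryCanonicalModel.canonicalModel_exists_printed)
      (F : HodgeCM.CMField) [IsGalois ℚ F] (h6 : 6 ≤ Module.finrank ℚ F) {ι₁ : F →+* ℂ} (V : HodgeCM.HermSpace3 F ι₁) (a₀ : RealScalar F)
      (Φ : CMType F) (i : (I V (repAt a₀) (muLiu ι₁ GramClass.rep)))
      (t : (datum413 hDel F V a₀ Φ i).Triple) (hw : t.HasWeightOne) (hι : ι₁ ∈ t.cmType.1)
      (e : HodgeCM.CMField.K F) (a : (↥(maximalRealSubfield (HodgeCM.CMField.K F)))ˣ)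
      (he : Literature.AlgebraicGeometry.Liu2021.IsAdmissibleElement (HodgeCM.CMField.K F) t.cmType.1 e)
      (hae : ((a : ↥(maximalRealSubfield (HodgeCM.CMField.K F))) : HodgeCM.CMField.K F) = e * (2 * imagUnit (HodgeCM.CMField.K F))),
      ∀ (hV : IsAnisotropic F (HodgeCM.HermSpace3.Hm V)) (ha : IsCMField.complexConj (HodgeCM.CMField.K F) ((a : ↥(maximalRealSubfield (HodgeCM.CMField.K F))) : (HodgeCM.CMField.K F)) = ((a : ↥(maximalRealSubfield (HodgeCM.CMField.K F))) : (HodgeCM.CMField.K F))) (ha0 : ((a : ↥(maximalRealSubfield (HodgeCM.CMField.K F))) :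
        (HodgeCM.CMField.K F)) ≠ 0)
      (hpos : 0 < cmXW (HodgeCM.CMField.K F) (frameD V) (lineVec (HodgeCM.CMField.K F) (dW (cDiag Φ ι₁ ((a : ↥(maximalRealSubfield (HodgeCM.CMField.K F))) : (HodgeCM.CMField.K F)) ha ha0).D 0)) (fun _ => dW_real (cDiag Φ ι₁ ((a : ↥(maximalRealSubfield (HodgeCM.CMField.K F))) : (HodgeCM.CMField.K F)) ha ha0).D 0) ι₁ (cmPlace
          (HodgeCM.CMField.K F) ι₁) 0)
      (ĉ : UnitaryGroup.adelicPair (↥(maximalRealSubfield (HodgeCM.CMField.K F))) (HodgeCM.CMField.K F) (IsCMField.complexConj (HodgeCM.CMField.K F)) 3 1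
        (Matrix.diagonal (frameD V)) (Matrix.diagonal (lineVec (HodgeCM.CMField.K F) ((a : ↥(maximalRealSubfield (HodgeCM.CMField.K F))) : (HodgeCM.CMField.K F)))) →* ℂˣ),
      (chiSplitting (HodgeCM.CMField.K F) e₁ (frameD V) (frameD_real V) (frameD_ne V) (lineVec (HodgeCM.CMField.K F) ((a : ↥(maximalRealSubfield (HodgeCM.CMField.K F))) : (HodgeCM.CMField.K F))) (complexConj_lineVec_coe (HodgeCM.CMField.K F) a) (lineVec_coe_ne_zero (HodgeCM.CMField.K F) a)
          (Literature.NumberTheory.Automorphic.IdeleClassGroup.toHeckeCharacter (HodgeCM.CMField.K F) t.μ) (Literature.NumberTheory.Automorphic.IdeleClassGroup.isUnitary_toHeckeCharacter (HodgeCM.CMField.K F) t.μ) ((Literature.RepresentationTheory.Liu2021.isOscillatorChar_toHeckeCharacter_iff t.μ).mpr t.isConjugateSymplectic)) =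
        adelicMpCont.twist (↥(maximalRealSubfield (HodgeCM.CMField.K F))) (Fin 3) _ (splittingOf _ _ _ _ _ _ _ _ _ _ _ _ _ _ _ _ _ (compat_line₀ V Φ ι₁ ((a : ↥(maximalRealSubfield (HodgeCM.CMField.K F))) : (HodgeCM.CMField.K F)) ha ha0)) ĉ →
      (∀ γU ∈ (UnitaryGroup.toAdelic (↥(maximalRealSubfield (HodgeCM.CMField.K F))) (HodgeCM.CMField.K F) (IsCMField.complexConj (HodgeCM.CMField.K F)) 3 (Matrix.diagonal (frameD V))).range, ĉ ((UnitaryGroup.adelicInl (↥(maximalRealSubfield (HodgeCM.CMField.K F))) (HodgeCM.CMField.K F) (IsCMField.complexConj (HodgeCM.CMField.K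
          F)) 3 1 (Matrix.diagonal (frameD V)) (Matrix.diagonal (lineVec (HodgeCM.CMField.K F) ((a : ↥(maximalRealSubfield (HodgeCM.CMField.K F))) : (HodgeCM.CMField.K F))))) γU) = 1) →
      (∀ γ ∈ (UnitaryGroup.toAdelic (↥(maximalRealSubfield (HodgeCM.CMField.K F))) (HodgeCM.CMField.K F) (IsCMField.complexConj (HodgeCM.CMField.K F)) 1 (Matrix.diagonal (lineVec (HodgeCM.CMField.K F) ((a : ↥(maximalRealSubfield (HodgeCM.CMField.K F))) : (HodgeCM.CMField.K F))))).range, ĉ ((UnitaryGroup.adelicInr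
          (↥(maximalRealSubfield (HodgeCM.CMField.K F))) (HodgeCM.CMField.K F) (IsCMField.complexConj (HodgeCM.CMField.K F)) 3 1 (Matrix.diagonal (frameD V)) (Matrix.diagonal (lineVec (HodgeCM.CMField.K F) ((a : ↥(maximalRealSubfield (HodgeCM.CMField.K F))) : (HodgeCM.CMField.K F))))) γ) = 1) →
      Continuous ĉ →
      ∀ (hν : ∀ γU ∈ CMRat (HodgeCM.CMField.K F) (frameD V), ((cmLineChar₀ (HodgeCM.CMField.K F) finProdFinEquiv e₁ (frameD V) (frameD_real V) (frameD_ne V) (dW (cDiag Φ ι₁ ((a : ↥(maximalRealSubfield (HodgeCM.CMField.K F))) : (HodgeCM.CMField.K F)) ha ha0).D) (dW_real (cDiag Φ ι₁ ((a : ↥(maximalRealSubfield (HodgeCM.CMField.K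
          F))) : (HodgeCM.CMField.K F)) ha ha0).D) (dW_ne (cDiag Φ ι₁ ((a : ↥(maximalRealSubfield (HodgeCM.CMField.K F))) : (HodgeCM.CMField.K F)) ha ha0).D) (compat_plane V Φ ι₁ ((a : ↥(maximalRealSubfield (HodgeCM.CMField.K F))) : (HodgeCM.CMField.K F)) ha ha0) (compat_line₀ V Φ ι₁ ((a : ↥(maximalRealSubfield
          (HodgeCM.CMField.K F))) : (HodgeCM.CMField.K F)) ha ha0) (compat_line₁ V Φ ι₁ ((a : ↥(maximalRealSubfield (HodgeCM.CMField.K F))) : (HodgeCM.CMField.K F)) ha ha0)).comp (MonoidHom.inl _ _) * (ĉ.comp (UnitaryGroup.adelicInl (↥(maximalRealSubfield (HodgeCM.CMField.K F))) (HodgeCM.CMField.K F) (IsCMField.complexConj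
          (HodgeCM.CMField.K F)) 3 1 (Matrix.diagonal (frameD V)) (Matrix.diagonal (lineVec (HodgeCM.CMField.K F) ((a : ↥(maximalRealSubfield (HodgeCM.CMField.K F))) : (HodgeCM.CMField.K F))))))⁻¹) γU = 1)
        (hνc : Continuous fun v => ((((cmLineChar₀ (HodgeCM.CMField.K F) finProdFinEquiv e₁ (frameD V) (frameD_real V) (frameD_ne V) (dW (cDiag Φ ι₁ ((a : ↥(maximalRealSubfield (HodgeCM.CMField.K F))) : (HodgeCM.CMField.K F)) ha ha0).D) (dW_real (cDiag Φ ι₁ ((a : ↥(maximalRealSubfield (HodgeCM.CMField.K F))) :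
            (HodgeCM.CMField.K F)) ha ha0).D) (dW_ne (cDiag Φ ι₁ ((a : ↥(maximalRealSubfield (HodgeCM.CMField.K F))) : (HodgeCM.CMField.K F)) ha ha0).D) (compat_plane V Φ ι₁ ((a : ↥(maximalRealSubfield (HodgeCM.CMField.K F))) : (HodgeCM.CMField.K F)) ha ha0) (compat_line₀ V Φ ι₁ ((a : ↥(maximalRealSubfield (HodgeCM.CMField.K
            F))) : (HodgeCM.CMField.K F)) ha ha0) (compat_line₁ V Φ ι₁ ((a : ↥(maximalRealSubfield (HodgeCM.CMField.K F))) : (HodgeCM.CMField.K F)) ha ha0)).comp (MonoidHom.inl _ _) * (ĉ.comp (UnitaryGroup.adelicInl (↥(maximalRealSubfield (HodgeCM.CMField.K F))) (HodgeCM.CMField.K F) (IsCMField.complexConj (HodgeCM.CMField.K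
            F)) 3 1 (Matrix.diagonal (frameD V)) (Matrix.diagonal (lineVec (HodgeCM.CMField.K F) ((a : ↥(maximalRealSubfield (HodgeCM.CMField.K F))) : (HodgeCM.CMField.K F))))))⁻¹) v : ℂˣ) : ℂ))
        (A : ∀ k : Fin 4, ArchLineInput V (lineRepT V (cDiag Φ ι₁ ((a : ↥(maximalRealSubfield (HodgeCM.CMField.K F))) : (HodgeCM.CMField.K F)) ha ha0).D (compat_plane V Φ ι₁ ((a : ↥(maximalRealSubfield (HodgeCM.CMField.K F))) : (HodgeCM.CMField.K F)) ha ha0) (compat_line₀ V Φ ι₁ ((a : ↥(maximalRealSubfield (HodgeCM.CMField.K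
            F))) : (HodgeCM.CMField.K F)) ha ha0) (compat_line₁ V Φ ι₁ ((a : ↥(maximalRealSubfield (HodgeCM.CMField.K F))) : (HodgeCM.CMField.K F)) ha ha0) (compat_line₂ V Φ ι₁ ((a : ↥(maximalRealSubfield (HodgeCM.CMField.K F))) : (HodgeCM.CMField.K F)) ha ha0) (compat_line₃ V Φ ι₁ ((a : ↥(maximalRealSubfield (HodgeCM.CMField.K
            F))) : (HodgeCM.CMField.K F)) ha ha0) (1 : CMAdelic (HodgeCM.CMField.K F) (frameD V) × CMAdelic (HodgeCM.CMField.K F) (dW (cDiag Φ ι₁ ((a : ↥(maximalRealSubfield (HodgeCM.CMField.K F))) : (HodgeCM.CMField.K F)) ha ha0).D) →* ℂˣ) ((cmLineChar₀ (HodgeCM.CMField.K F) finProdFinEquiv e₁ (frameD V) (frameD_real V)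
            (frameD_ne V) (dW (cDiag Φ ι₁ ((a : ↥(maximalRealSubfield (HodgeCM.CMField.K F))) : (HodgeCM.CMField.K F)) ha ha0).D) (dW_real (cDiag Φ ι₁ ((a : ↥(maximalRealSubfield (HodgeCM.CMField.K F))) : (HodgeCM.CMField.K F)) ha ha0).D) (dW_ne (cDiag Φ ι₁ ((a : ↥(maximalRealSubfield (HodgeCM.CMField.K F))) :
            (HodgeCM.CMField.K F)) ha ha0).D) (compat_plane V Φ ι₁ ((a : ↥(maximalRealSubfield (HodgeCM.CMField.K F))) : (HodgeCM.CMField.K F)) ha ha0) (compat_line₀ V Φ ι₁ ((a : ↥(maximalRealSubfield (HodgeCM.CMField.K F))) : (HodgeCM.CMField.K F)) ha ha0) (compat_line₁ V Φ ι₁ ((a : ↥(maximalRealSubfield (HodgeCM.CMField.K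
            F))) : (HodgeCM.CMField.K F)) ha ha0)).comp (MonoidHom.inl _ _) * (ĉ.comp (UnitaryGroup.adelicInl (↥(maximalRealSubfield (HodgeCM.CMField.K F))) (HodgeCM.CMField.K F) (IsCMField.complexConj (HodgeCM.CMField.K F)) 3 1 (Matrix.diagonal (frameD V)) (Matrix.diagonal (lineVec (HodgeCM.CMField.K F) ((a :
            ↥(maximalRealSubfield (HodgeCM.CMField.K F))) : (HodgeCM.CMField.K F))))))⁻¹) k))
        (harm : ∀ (u : ↥(stabilizer U21 x₀)) (ℓ : Module.Dual ℂ (Fin 2 → ℂ)),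
          lineOmega_zero V (cDiag Φ ι₁ ((a : ↥(maximalRealSubfield (HodgeCM.CMField.K F))) : (HodgeCM.CMField.K F)) ha ha0).D (compat_plane V Φ ι₁ ((a : ↥(maximalRealSubfield (HodgeCM.CMField.K F))) : (HodgeCM.CMField.K F)) ha ha0) (compat_line₀ V Φ ι₁ ((a : ↥(maximalRealSubfield (HodgeCM.CMField.K F))) : (HodgeCM.CMField.K F))
              ha ha0) (compat_line₁ V Φ ι₁ ((a : ↥(maximalRealSubfield (HodgeCM.CMField.K F))) : (HodgeCM.CMField.K F)) ha ha0) (etaT₀ V (cDiag Φ ι₁ ((a : ↥(maximalRealSubfield (HodgeCM.CMField.K F))) : (HodgeCM.CMField.K F)) ha ha0).D (1 : CMAdelic (HodgeCM.CMField.K F) (frameD V) × CMAdelic (HodgeCM.CMField.K F) (dW (cDiag Φ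
              ι₁ ((a : ↥(maximalRealSubfield (HodgeCM.CMField.K F))) : (HodgeCM.CMField.K F)) ha ha0).D) →* ℂˣ) ((cmLineChar₀ (HodgeCM.CMField.K F) finProdFinEquiv e₁ (frameD V) (frameD_real V) (frameD_ne V) (dW (cDiag Φ ι₁ ((a : ↥(maximalRealSubfield (HodgeCM.CMField.K F))) : (HodgeCM.CMField.K F)) ha ha0).D) (dW_real (cDiag Φ
              ι₁ ((a : ↥(maximalRealSubfield (HodgeCM.CMField.K F))) : (HodgeCM.CMField.K F)) ha ha0).D) (dW_ne (cDiag Φ ι₁ ((a : ↥(maximalRealSubfield (HodgeCM.CMField.K F))) : (HodgeCM.CMField.K F)) ha ha0).D) (compat_plane V Φ ι₁ ((a : ↥(maximalRealSubfield (HodgeCM.CMField.K F))) : (HodgeCM.CMField.K F)) ha ha0)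
              (compat_line₀ V Φ ι₁ ((a : ↥(maximalRealSubfield (HodgeCM.CMField.K F))) : (HodgeCM.CMField.K F)) ha ha0) (compat_line₁ V Φ ι₁ ((a : ↥(maximalRealSubfield (HodgeCM.CMField.K F))) : (HodgeCM.CMField.K F)) ha ha0)).comp (MonoidHom.inl _ _) * (ĉ.comp (UnitaryGroup.adelicInl (↥(maximalRealSubfield (HodgeCM.CMField.K
              F))) (HodgeCM.CMField.K F) (IsCMField.complexConj (HodgeCM.CMField.K F)) 3 1 (Matrix.diagonal (frameD V)) (Matrix.diagonal (lineVec (HodgeCM.CMField.K F) ((a : ↥(maximalRealSubfield (HodgeCM.CMField.K F))) : (HodgeCM.CMField.K F))))))⁻¹)) (u : U21) ((blockFamilyOfAt (HodgeCM.CMField.K F) e₁ (frameD V) (frameD_real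
              V) (frameD_ne V) (lineVec (HodgeCM.CMField.K F) (dW (cDiag Φ ι₁ ((a : ↥(maximalRealSubfield (HodgeCM.CMField.K F))) : (HodgeCM.CMField.K F)) ha ha0).D 0)) (fun _ => dW_real (cDiag Φ ι₁ ((a : ↥(maximalRealSubfield (HodgeCM.CMField.K F))) : (HodgeCM.CMField.K F)) ha ha0).D 0) (fun _ => dW_ne (cDiag Φ ι₁ ((a :
              ↥(maximalRealSubfield (HodgeCM.CMField.K F))) : (HodgeCM.CMField.K F)) ha ha0).D 0) ι₁ (blockPosEquiv V) (blockNegEquiv V) (posIdxEquivUnit hpos) (negIdxEquivEmpty hpos) (degOnePDual Empty) (binvPi 1)) ℓ) =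
            (blockFamilyOfAt (HodgeCM.CMField.K F) e₁ (frameD V) (frameD_real V) (frameD_ne V) (lineVec (HodgeCM.CMField.K F) (dW (cDiag Φ ι₁ ((a : ↥(maximalRealSubfield (HodgeCM.CMField.K F))) : (HodgeCM.CMField.K F)) ha ha0).D 0)) (fun _ => dW_real (cDiag Φ ι₁ ((a : ↥(maximalRealSubfield (HodgeCM.CMField.K F))) :
                (HodgeCM.CMField.K F)) ha ha0).D 0) (fun _ => dW_ne (cDiag Φ ι₁ ((a : ↥(maximalRealSubfield (HodgeCM.CMField.K F))) : (HodgeCM.CMField.K F)) ha ha0).D 0) ι₁ (blockPosEquiv V) (blockNegEquiv V) (posIdxEquivUnit hpos) (negIdxEquivEmpty hpos) (degOnePDual Empty) (binvPi 1))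
                ((BallForms.isPullbackCocycle_cotangentCocycle.weightOf x₀).dual u ℓ))
        (hdef : ∀ g : UnitaryGroup.arch (↥(maximalRealSubfield (HodgeCM.CMField.K F))) (HodgeCM.CMField.K F) (IsCMField.complexConj (HodgeCM.CMField.K F)) 3 V.Hm,
          UnitaryGroup.archAt (↥(maximalRealSubfield (HodgeCM.CMField.K F))) (HodgeCM.CMField.K F) (IsCMField.complexConj (HodgeCM.CMField.K F)) 3 V.Hm (UnitaryGroup.cmPlace (HodgeCM.CMField.K F) ι₁) (NumberField.complexConj_smul_infinitePlace (HodgeCM.CMField.K F) _) (IsCMField.complexConj_ne_one (HodgeCM.CMField.K F)) g = 1 →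
          ∀ (ℓ : Module.Dual ℂ (Fin 2 → ℂ)) (Φf : FinSB (↥(maximalRealSubfield (HodgeCM.CMField.K F))) (Fin 3)),
            lineRepOf V (cDiag Φ ι₁ ((a : ↥(maximalRealSubfield (HodgeCM.CMField.K F))) : (HodgeCM.CMField.K F)) ha ha0).D (compat_plane V Φ ι₁ ((a : ↥(maximalRealSubfield (HodgeCM.CMField.K F))) : (HodgeCM.CMField.K F)) ha ha0) (compat_line₀ V Φ ι₁ ((a : ↥(maximalRealSubfield (HodgeCM.CMField.K F))) : (HodgeCM.CMField.K F)) ha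
                ha0) (compat_line₁ V Φ ι₁ ((a : ↥(maximalRealSubfield (HodgeCM.CMField.K F))) : (HodgeCM.CMField.K F)) ha ha0) (compat_line₂ V Φ ι₁ ((a : ↥(maximalRealSubfield (HodgeCM.CMField.K F))) : (HodgeCM.CMField.K F)) ha ha0) (compat_line₃ V Φ ι₁ ((a : ↥(maximalRealSubfield (HodgeCM.CMField.K F))) : (HodgeCM.CMField.K
                F)) ha ha0) (etaT₀ V (cDiag Φ ι₁ ((a : ↥(maximalRealSubfield (HodgeCM.CMField.K F))) : (HodgeCM.CMField.K F)) ha ha0).D (1 : CMAdelic (HodgeCM.CMField.K F) (frameD V) × CMAdelic (HodgeCM.CMField.K F) (dW (cDiag Φ ι₁ ((a : ↥(maximalRealSubfield (HodgeCM.CMField.K F))) : (HodgeCM.CMField.K F)) ha ha0).D) →* ℂˣ)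
                ((cmLineChar₀ (HodgeCM.CMField.K F) finProdFinEquiv e₁ (frameD V) (frameD_real V) (frameD_ne V) (dW (cDiag Φ ι₁ ((a : ↥(maximalRealSubfield (HodgeCM.CMField.K F))) : (HodgeCM.CMField.K F)) ha ha0).D) (dW_real (cDiag Φ ι₁ ((a : ↥(maximalRealSubfield (HodgeCM.CMField.K F))) : (HodgeCM.CMField.K F)) ha ha0).D)
                (dW_ne (cDiag Φ ι₁ ((a : ↥(maximalRealSubfield (HodgeCM.CMField.K F))) : (HodgeCM.CMField.K F)) ha ha0).D) (compat_plane V Φ ι₁ ((a : ↥(maximalRealSubfield (HodgeCM.CMField.K F))) : (HodgeCM.CMField.K F)) ha ha0) (compat_line₀ V Φ ι₁ ((a : ↥(maximalRealSubfield (HodgeCM.CMField.K F))) : (HodgeCM.CMField.K F)) ha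
                ha0) (compat_line₁ V Φ ι₁ ((a : ↥(maximalRealSubfield (HodgeCM.CMField.K F))) : (HodgeCM.CMField.K F)) ha ha0)).comp (MonoidHom.inl _ _) * (ĉ.comp (UnitaryGroup.adelicInl (↥(maximalRealSubfield (HodgeCM.CMField.K F))) (HodgeCM.CMField.K F) (IsCMField.complexConj (HodgeCM.CMField.K F)) 3 1 (Matrix.diagonal
                (frameD V)) (Matrix.diagonal (lineVec (HodgeCM.CMField.K F) ((a : ↥(maximalRealSubfield (HodgeCM.CMField.K F))) : (HodgeCM.CMField.K F))))))⁻¹))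
                (etaT₁ V (cDiag Φ ι₁ ((a : ↥(maximalRealSubfield (HodgeCM.CMField.K F))) : (HodgeCM.CMField.K F)) ha ha0).D (1 : CMAdelic (HodgeCM.CMField.K F) (frameD V) × CMAdelic (HodgeCM.CMField.K F) (dW (cDiag Φ ι₁ ((a : ↥(maximalRealSubfield (HodgeCM.CMField.K F))) : (HodgeCM.CMField.K F)) ha ha0).D) →* ℂˣ) ((cmLineChar₀
                    (HodgeCM.CMField.K F) finProdFinEquiv e₁ (frameD V) (frameD_real V) (frameD_ne V) (dW (cDiag Φ ι₁ ((a : ↥(maximalRealSubfield (HodgeCM.CMField.K F))) : (HodgeCM.CMField.K F)) ha ha0).D) (dW_real (cDiag Φ ι₁ ((a : ↥(maximalRealSubfield (HodgeCM.CMField.K F))) : (HodgeCM.CMField.K F)) ha ha0).D) (dW_ne (cDiag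
                    Φ ι₁ ((a : ↥(maximalRealSubfield (HodgeCM.CMField.K F))) : (HodgeCM.CMField.K F)) ha ha0).D) (compat_plane V Φ ι₁ ((a : ↥(maximalRealSubfield (HodgeCM.CMField.K F))) : (HodgeCM.CMField.K F)) ha ha0) (compat_line₀ V Φ ι₁ ((a : ↥(maximalRealSubfield (HodgeCM.CMField.K F))) : (HodgeCM.CMField.K F)) ha ha0)
                    (compat_line₁ V Φ ι₁ ((a : ↥(maximalRealSubfield (HodgeCM.CMField.K F))) : (HodgeCM.CMField.K F)) ha ha0)).comp (MonoidHom.inl _ _) * (ĉ.comp (UnitaryGroup.adelicInl (↥(maximalRealSubfield (HodgeCM.CMField.K F))) (HodgeCM.CMField.K F) (IsCMField.complexConj (HodgeCM.CMField.K F)) 3 1 (Matrix.diagonal (frameD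
                    V)) (Matrix.diagonal (lineVec (HodgeCM.CMField.K F) ((a : ↥(maximalRealSubfield (HodgeCM.CMField.K F))) : (HodgeCM.CMField.K F))))))⁻¹)) (eta₂ V (cDiag Φ ι₁ ((a : ↥(maximalRealSubfield (HodgeCM.CMField.K F))) : (HodgeCM.CMField.K F)) ha ha0).D (1 : CMAdelic (HodgeCM.CMField.K F) (frameD V) × CMAdelic
                    (HodgeCM.CMField.K F) (dW (cDiag Φ ι₁ ((a : ↥(maximalRealSubfield (HodgeCM.CMField.K F))) : (HodgeCM.CMField.K F)) ha ha0).D) →* ℂˣ)) (eta₃ V (cDiag Φ ι₁ ((a : ↥(maximalRealSubfield (HodgeCM.CMField.K F))) : (HodgeCM.CMField.K F)) ha ha0).D (1 : CMAdelic (HodgeCM.CMField.K F) (frameD V) × CMAdelic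
                    (HodgeCM.CMField.K F) (dW (cDiag Φ ι₁ ((a : ↥(maximalRealSubfield (HodgeCM.CMField.K F))) : (HodgeCM.CMField.K F)) ha ha0).D) →* ℂˣ)) 0
                (HodgeCM.Adelic.regimeEquiv F V.Hm hV (UnitaryGroup.archToAdelic (↥(maximalRealSubfield (HodgeCM.CMField.K F))) (HodgeCM.CMField.K F) (IsCMField.complexConj (HodgeCM.CMField.K F)) 3 V.Hm g), 1)
                (piSchwartzBruhatEquiv (↥(maximalRealSubfield (HodgeCM.CMField.K F))) (Fin 3) ((blockFamilyOfAt (HodgeCM.CMField.K F) e₁ (frameD V) (frameD_real V) (frameD_ne V) (lineVec (HodgeCM.CMField.K F) (dW (cDiag Φ ι₁ ((a : ↥(maximalRealSubfield (HodgeCM.CMField.K F))) : (HodgeCM.CMField.K F)) ha ha0).D 0)) (fun _ =>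
                    dW_real (cDiag Φ ι₁ ((a : ↥(maximalRealSubfield (HodgeCM.CMField.K F))) : (HodgeCM.CMField.K F)) ha ha0).D 0) (fun _ => dW_ne (cDiag Φ ι₁ ((a : ↥(maximalRealSubfield (HodgeCM.CMField.K F))) : (HodgeCM.CMField.K F)) ha ha0).D 0) ι₁ (blockPosEquiv V) (blockNegEquiv V) (posIdxEquivUnit hpos) (negIdxEquivEmpty
                    hpos) (degOnePDual Empty) (binvPi 1)) ℓ ⊗ₜ[ℂ] Φf)) =
              piSchwartzBruhatEquiv (↥(maximalRealSubfield (HodgeCM.CMField.K F))) (Fin 3) ((blockFamilyOfAt (HodgeCM.CMField.K F) e₁ (frameD V) (frameD_real V) (frameD_ne V) (lineVec (HodgeCM.CMField.K F) (dW (cDiag Φ ι₁ ((a : ↥(maximalRealSubfield (HodgeCM.CMField.K F))) : (HodgeCM.CMField.K F)) ha ha0).D 0)) (fun _ =>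
                  dW_real (cDiag Φ ι₁ ((a : ↥(maximalRealSubfield (HodgeCM.CMField.K F))) : (HodgeCM.CMField.K F)) ha ha0).D 0) (fun _ => dW_ne (cDiag Φ ι₁ ((a : ↥(maximalRealSubfield (HodgeCM.CMField.K F))) : (HodgeCM.CMField.K F)) ha ha0).D 0) ι₁ (blockPosEquiv V) (blockNegEquiv V) (posIdxEquivUnit hpos) (negIdxEquivEmpty
                  hpos) (degOnePDual Empty) (binvPi 1)) ℓ ⊗ₜ[ℂ] Φf)),
      ∃ χM : PontryaginDual (↥(Literature.NumberTheory.Automorphic.relNormOneIdeles (↥(maximalRealSubfield (HodgeCM.CMField.K F))) (HodgeCM.CMField.K F)) ⧸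
          Literature.NumberTheory.Automorphic.relNormOneRat (↥(maximalRealSubfield (HodgeCM.CMField.K F))) (HodgeCM.CMField.K F)),
        (∀ u : UfZero (cDiag Φ ι₁ ((a : ↥(maximalRealSubfield (HodgeCM.CMField.K F))) : (HodgeCM.CMField.K F)) ha ha0).D,
          (distDatumAt V Φ ι₁ ((a : ↥(maximalRealSubfield (HodgeCM.CMField.K F))) : (HodgeCM.CMField.K F)) ha ha0 (1 : CMAdelic (HodgeCM.CMField.K F) (frameD V) × CMAdelic (HodgeCM.CMField.K F) (dW (cDiag Φ ι₁ ((a : ↥(maximalRealSubfield (HodgeCM.CMField.K F))) : (HodgeCM.CMField.K F)) ha ha0).D) →* ℂˣ) (one_apply_rat_eq_one V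
              (cDiag Φ ι₁ ((a : ↥(maximalRealSubfield (HodgeCM.CMField.K F))) : (HodgeCM.CMField.K F)) ha ha0)) (continuous_one_val V (cDiag Φ ι₁ ((a : ↥(maximalRealSubfield (HodgeCM.CMField.K F))) : (HodgeCM.CMField.K F)) ha ha0)) ((cmLineChar₀ (HodgeCM.CMField.K F) finProdFinEquiv e₁ (frameD V) (frameD_real V) (frameD_ne V)
              (dW (cDiag Φ ι₁ ((a : ↥(maximalRealSubfield (HodgeCM.CMField.K F))) : (HodgeCM.CMField.K F)) ha ha0).D) (dW_real (cDiag Φ ι₁ ((a : ↥(maximalRealSubfield (HodgeCM.CMField.K F))) : (HodgeCM.CMField.K F)) ha ha0).D) (dW_ne (cDiag Φ ι₁ ((a : ↥(maximalRealSubfield (HodgeCM.CMField.K F))) : (HodgeCM.CMField.K F)) ha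
              ha0).D) (compat_plane V Φ ι₁ ((a : ↥(maximalRealSubfield (HodgeCM.CMField.K F))) : (HodgeCM.CMField.K F)) ha ha0) (compat_line₀ V Φ ι₁ ((a : ↥(maximalRealSubfield (HodgeCM.CMField.K F))) : (HodgeCM.CMField.K F)) ha ha0) (compat_line₁ V Φ ι₁ ((a : ↥(maximalRealSubfield (HodgeCM.CMField.K F))) : (HodgeCM.CMField.K
              F)) ha ha0)).comp (MonoidHom.inl _ _) * (ĉ.comp (UnitaryGroup.adelicInl (↥(maximalRealSubfield (HodgeCM.CMField.K F))) (HodgeCM.CMField.K F) (IsCMField.complexConj (HodgeCM.CMField.K F)) 3 1 (Matrix.diagonal (frameD V)) (Matrix.diagonal (lineVec (HodgeCM.CMField.K F) ((a : ↥(maximalRealSubfield (HodgeCM.CMField.K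
              F))) : (HodgeCM.CMField.K F))))))⁻¹) hν hνc A hV (blockFamilyOfAt (HodgeCM.CMField.K F) e₁ (frameD V) (frameD_real V) (frameD_ne V) (lineVec (HodgeCM.CMField.K F) (dW (cDiag Φ ι₁ ((a : ↥(maximalRealSubfield (HodgeCM.CMField.K F))) : (HodgeCM.CMField.K F)) ha ha0).D 0)) (fun _ => dW_real (cDiag Φ ι₁ ((a :
              ↥(maximalRealSubfield (HodgeCM.CMField.K F))) : (HodgeCM.CMField.K F)) ha ha0).D 0) (fun _ => dW_ne (cDiag Φ ι₁ ((a : ↥(maximalRealSubfield (HodgeCM.CMField.K F))) : (HodgeCM.CMField.K F)) ha ha0).D 0) ι₁ (blockPosEquiv V) (blockNegEquiv V) (posIdxEquivUnit hpos) (negIdxEquivEmpty hpos) (degOnePDual Empty) (binvPi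
              1)) harm hdef).chiFin χM u = finCharZero V (cDiag Φ ι₁ ((a : ↥(maximalRealSubfield (HodgeCM.CMField.K F))) : (HodgeCM.CMField.K F)) ha ha0).D (compat_plane V Φ ι₁ ((a : ↥(maximalRealSubfield (HodgeCM.CMField.K F))) : (HodgeCM.CMField.K F)) ha ha0) (compat_line₀ V Φ ι₁ ((a : ↥(maximalRealSubfield (HodgeCM.CMField.K
              F))) : (HodgeCM.CMField.K F)) ha ha0) (compat_line₁ V Φ ι₁ ((a : ↥(maximalRealSubfield (HodgeCM.CMField.K F))) : (HodgeCM.CMField.K F)) ha ha0) (etaT₀ V (cDiag Φ ι₁ ((a : ↥(maximalRealSubfield (HodgeCM.CMField.K F))) : (HodgeCM.CMField.K F)) ha ha0).D (1 : CMAdelic (HodgeCM.CMField.K F) (frameD V) × CMAdelic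
              (HodgeCM.CMField.K F) (dW (cDiag Φ ι₁ ((a : ↥(maximalRealSubfield (HodgeCM.CMField.K F))) : (HodgeCM.CMField.K F)) ha ha0).D) →* ℂˣ) ((cmLineChar₀ (HodgeCM.CMField.K F) finProdFinEquiv e₁ (frameD V) (frameD_real V) (frameD_ne V) (dW (cDiag Φ ι₁ ((a : ↥(maximalRealSubfield (HodgeCM.CMField.K F))) :
              (HodgeCM.CMField.K F)) ha ha0).D) (dW_real (cDiag Φ ι₁ ((a : ↥(maximalRealSubfield (HodgeCM.CMField.K F))) : (HodgeCM.CMField.K F)) ha ha0).D) (dW_ne (cDiag Φ ι₁ ((a : ↥(maximalRealSubfield (HodgeCM.CMField.K F))) : (HodgeCM.CMField.K F)) ha ha0).D) (compat_plane V Φ ι₁ ((a : ↥(maximalRealSubfield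
              (HodgeCM.CMField.K F))) : (HodgeCM.CMField.K F)) ha ha0) (compat_line₀ V Φ ι₁ ((a : ↥(maximalRealSubfield (HodgeCM.CMField.K F))) : (HodgeCM.CMField.K F)) ha ha0) (compat_line₁ V Φ ι₁ ((a : ↥(maximalRealSubfield (HodgeCM.CMField.K F))) : (HodgeCM.CMField.K F)) ha ha0)).comp (MonoidHom.inl _ _) * (ĉ.comp
              (UnitaryGroup.adelicInl (↥(maximalRealSubfield (HodgeCM.CMField.K F))) (HodgeCM.CMField.K F) (IsCMField.complexConj (HodgeCM.CMField.K F)) 3 1 (Matrix.diagonal (frameD V)) (Matrix.diagonal (lineVec (HodgeCM.CMField.K F) ((a : ↥(maximalRealSubfield (HodgeCM.CMField.K F))) : (HodgeCM.CMField.K F))))))⁻¹)) (1, u) *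
              (((ĉ.comp ((MonoidHom.noncommCoprod (UnitaryGroup.adelicInl (↥(maximalRealSubfield (HodgeCM.CMField.K F))) (HodgeCM.CMField.K F) (IsCMField.complexConj (HodgeCM.CMField.K F)) 3 1 (Matrix.diagonal (frameD V)) (Matrix.diagonal (lineVec (HodgeCM.CMField.K F) ((a : ↥(maximalRealSubfield (HodgeCM.CMField.K F))) :
              (HodgeCM.CMField.K F))))) (UnitaryGroup.adelicInr (↥(maximalRealSubfield (HodgeCM.CMField.K F))) (HodgeCM.CMField.K F) (IsCMField.complexConj (HodgeCM.CMField.K F)) 3 1 (Matrix.diagonal (frameD V)) (Matrix.diagonal (lineVec (HodgeCM.CMField.K F) ((a : ↥(maximalRealSubfield (HodgeCM.CMField.K F))) :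
              (HodgeCM.CMField.K F))))) (UnitaryGroup.commute_adelicInl_adelicInr (↥(maximalRealSubfield (HodgeCM.CMField.K F))) (HodgeCM.CMField.K F) (IsCMField.complexConj (HodgeCM.CMField.K F)) 3 1 (Matrix.diagonal (frameD V)) (Matrix.diagonal (lineVec (HodgeCM.CMField.K F) ((a : ↥(maximalRealSubfield (HodgeCM.CMField.K F)))
              : (HodgeCM.CMField.K F)))))).comp (finPairToAdelic (↥(maximalRealSubfield (HodgeCM.CMField.K F))) (HodgeCM.CMField.K F) (IsCMField.complexConj (HodgeCM.CMField.K F)) 3 1 (Matrix.diagonal (frameD V)) (Matrix.diagonal (lineVec (HodgeCM.CMField.K F) ((a : ↥(maximalRealSubfield (HodgeCM.CMField.K F))) :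
              (HodgeCM.CMField.K F))))))).comp (MonoidHom.inr _ _))⁻¹ * ((lineChar (↥(maximalRealSubfield (HodgeCM.CMField.K F))) (HodgeCM.CMField.K F) (IsCMField.complexConj (HodgeCM.CMField.K F)) a t.χ.1).comp (MulEquiv.subgroupCongr (finAdelic_JW_eq (HodgeCM.CMField.K F) a)).symm.toMonoidHom)) u) ∧
        ∃ Φf : FinSB (↥(maximalRealSubfield (HodgeCM.CMField.K F))) (Fin 3), (distDatumAt V Φ ι₁ ((a : ↥(maximalRealSubfield (HodgeCM.CMField.K F))) : (HodgeCM.CMField.K F)) ha ha0 (1 : CMAdelic (HodgeCM.CMField.K F) (frameD V) × CMAdelic (HodgeCM.CMField.K F) (dW (cDiag Φ ι₁ ((a : ↥(maximalRealSubfield (HodgeCM.CMField.K F)))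
            : (HodgeCM.CMField.K F)) ha ha0).D) →* ℂˣ) (one_apply_rat_eq_one V (cDiag Φ ι₁ ((a : ↥(maximalRealSubfield (HodgeCM.CMField.K F))) : (HodgeCM.CMField.K F)) ha ha0)) (continuous_one_val V (cDiag Φ ι₁ ((a : ↥(maximalRealSubfield (HodgeCM.CMField.K F))) : (HodgeCM.CMField.K F)) ha ha0)) ((cmLineChar₀ (HodgeCM.CMField.K
            F) finProdFinEquiv e₁ (frameD V) (frameD_real V) (frameD_ne V) (dW (cDiag Φ ι₁ ((a : ↥(maximalRealSubfield (HodgeCM.CMField.K F))) : (HodgeCM.CMField.K F)) ha ha0).D) (dW_real (cDiag Φ ι₁ ((a : ↥(maximalRealSubfield (HodgeCM.CMField.K F))) : (HodgeCM.CMField.K F)) ha ha0).D) (dW_ne (cDiag Φ ι₁ ((a :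
            ↥(maximalRealSubfield (HodgeCM.CMField.K F))) : (HodgeCM.CMField.K F)) ha ha0).D) (compat_plane V Φ ι₁ ((a : ↥(maximalRealSubfield (HodgeCM.CMField.K F))) : (HodgeCM.CMField.K F)) ha ha0) (compat_line₀ V Φ ι₁ ((a : ↥(maximalRealSubfield (HodgeCM.CMField.K F))) : (HodgeCM.CMField.K F)) ha ha0) (compat_line₁ V Φ ι₁
            ((a : ↥(maximalRealSubfield (HodgeCM.CMField.K F))) : (HodgeCM.CMField.K F)) ha ha0)).comp (MonoidHom.inl _ _) * (ĉ.comp (UnitaryGroup.adelicInl (↥(maximalRealSubfield (HodgeCM.CMField.K F))) (HodgeCM.CMField.K F) (IsCMField.complexConj (HodgeCM.CMField.K F)) 3 1 (Matrix.diagonal (frameD V)) (Matrix.diagonal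
            (lineVec (HodgeCM.CMField.K F) ((a : ↥(maximalRealSubfield (HodgeCM.CMField.K F))) : (HodgeCM.CMField.K F))))))⁻¹) hν hνc A hV (blockFamilyOfAt (HodgeCM.CMField.K F) e₁ (frameD V) (frameD_real V) (frameD_ne V) (lineVec (HodgeCM.CMField.K F) (dW (cDiag Φ ι₁ ((a : ↥(maximalRealSubfield (HodgeCM.CMField.K F))) :
            (HodgeCM.CMField.K F)) ha ha0).D 0)) (fun _ => dW_real (cDiag Φ ι₁ ((a : ↥(maximalRealSubfield (HodgeCM.CMField.K F))) : (HodgeCM.CMField.K F)) ha ha0).D 0) (fun _ => dW_ne (cDiag Φ ι₁ ((a : ↥(maximalRealSubfield (HodgeCM.CMField.K F))) : (HodgeCM.CMField.K F)) ha ha0).D 0) ι₁ (blockPosEquiv V) (blockNegEquiv V)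
            (posIdxEquivUnit hpos) (negIdxEquivEmpty hpos) (degOnePDual Empty) (binvPi 1)) harm hdef).dist (charInv χM) Φf ≠ 0 := by
  intro hDel F _ h6 ι₁ V a₀ Φ i t hw hι e a he hae hV ha ha0 hpos ĉ hĉ hĉV hĉW hĉc hν hνc A harm hdef
  -- (0) degree, normality, compactness, the Borel σ-algebra of `[U(⟨a⟩)]`
  have h4 : 4 ≤ Module.finrank ℚ (F : Type) := le_trans (by norm_num) h6
  haveI hnormal : (CMRat (F : Type) (lineVec (F : Type) ((a : ↥(maximalRealSubfield (HodgeCM.CMField.K F))) : (HodgeCM.CMField.K F)))).Normal := normal_CMRat_line (F : Type) _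
  haveI hcW : CompactSpace (CMAdelic (F : Type) (lineVec (F : Type) ((a : ↥(maximalRealSubfield (HodgeCM.CMField.K F))) : (HodgeCM.CMField.K F))) ⧸ CMRat (F : Type) (lineVec (F : Type) ((a : ↥(maximalRealSubfield (HodgeCM.CMField.K F))) : (HodgeCM.CMField.K F)))) :=
    compactSpace_quotient_range_toAdelic_line (F : Type) _ (fun _ => ha) (fun _ => ha0)
  haveI hcV : CompactSpace (CMAdelic (F : Type) (frameD V) ⧸ CMRat (F : Type) (frameD V)) :=
    compactSpace_quotient_range_toAdelic_of_four_le_finrank (F : Type) ι₁ (frameD V) (frameD_real V) (frameD_sign_of_ne V) h4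
  letI mWq : MeasurableSpace (CMAdelic (F : Type) (lineVec (F : Type) ((a : ↥(maximalRealSubfield (HodgeCM.CMField.K F))) : (HodgeCM.CMField.K F))) ⧸ CMRat (F : Type) (lineVec (F : Type) ((a : ↥(maximalRealSubfield (HodgeCM.CMField.K F))) : (HodgeCM.CMField.K F)))) := borel _
  haveI : BorelSpace (CMAdelic (F : Type) (lineVec (F : Type) ((a : ↥(maximalRealSubfield (HodgeCM.CMField.K F))) : (HodgeCM.CMField.K F))) ⧸ CMRat (F : Type) (lineVec (F : Type) ((a : ↥(maximalRealSubfield (HodgeCM.CMField.K F))) : (HodgeCM.CMField.K F)))) := ⟨rfl⟩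
  -- (4) Weil's majorants for the CM line pair at the pin, `SK := univ`
  have hρ₀ := hasThetaMajorants_cmPairSplitting_of_signs (F : Type) e₁ (frameD V) (frameD_real V) (frameD_ne V)
    (lineVec (F : Type) ((a : ↥(maximalRealSubfield (HodgeCM.CMField.K F))) : (HodgeCM.CMField.K F))) (fun _ => ha) (fun _ => ha0) ι₁
    (compat_line₀ V Φ ι₁ ((a : ↥(maximalRealSubfield (HodgeCM.CMField.K F))) : (HodgeCM.CMField.K F)) ha ha0) (frameD_sign_ι₁' V)
    (re_line_sign (F : Type) ι₁ _ ha ha0) (frameD_sign_of_ne V)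
    (fun _ _ => Or.inl ⟨0, fun j hj => absurd (Subsingleton.elim j 0) hj⟩)
  have hSK : ∀ (h : CMAdelic (F : Type) (lineVec (F : Type) ((a : ↥(maximalRealSubfield (HodgeCM.CMField.K F))) : (HodgeCM.CMField.K F))))
      (Φ' : piSchwartzBruhat (↥(maximalRealSubfield (HodgeCM.CMField.K F))) (Fin 3)), Φ' ∈ (Set.univ : Set _) →
      cmPairRep (F : Type) e₁ (frameD V) (frameD_real V) (frameD_ne V)
        (lineVec (F : Type) ((a : ↥(maximalRealSubfield (HodgeCM.CMField.K F))) : (HodgeCM.CMField.K F))) (fun _ => ha) (fun _ => ha0)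
        (compat_line₀ V Φ ι₁ ((a : ↥(maximalRealSubfield (HodgeCM.CMField.K F))) : (HodgeCM.CMField.K F)) ha ha0) (1, h) Φ' ∈ (Set.univ : Set _) :=
    fun _ _ _ => Set.mem_univ _
  -- (5)–(9) THE PIN THETA LIFT IS NON-ZERO (level 1a ★ `pin_thetaLift_charCM_ne_zero`: Rallis at the pin + (A-PIN) + (FIN-PIN) + brick 7)
  obtain ⟨χ₂, hχ₂, Φf, hlift⟩ := pin_thetaLift_charCM_ne_zero hRpin hDel F h6 V a₀ Φ i t hw hι e a he hae ha ha0 hpos ĉ hĉ hĉW hĉc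
    hρ₀ Set.univ hSK
  -- (10) the model side at the line (★ `sideAt`/`distDatumAt`): continuity of the slot character `η₀ = etaT₀ 1 ν` and of `χ₀`, the J-R multiplier `κ₁`
  have hη₀c := continuous_etaT₀ V (cDiag Φ ι₁ ((a : ↥(maximalRealSubfield (HodgeCM.CMField.K F))) : (HodgeCM.CMField.K F)) ha ha0).D 1 _ (continuous_one_val V (cDiag Φ ι₁ ((a : ↥(maximalRealSubfield (HodgeCM.CMField.K F))) : (HodgeCM.CMField.K F)) ha ha0)) hνc
  have hχ₀c := continuous_cmLineChar₀_of_signs (HodgeCM.CMField.K F) finProdFinEquiv e₁ (frameD V) (frameD_real V) (frameD_ne V)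
    (dW (cDiag Φ ι₁ ((a : ↥(maximalRealSubfield (HodgeCM.CMField.K F))) : (HodgeCM.CMField.K F)) ha ha0).D) (dW_real (cDiag Φ ι₁ ((a : ↥(maximalRealSubfield (HodgeCM.CMField.K F))) : (HodgeCM.CMField.K F)) ha ha0).D) (dW_ne (cDiag Φ ι₁ ((a : ↥(maximalRealSubfield (HodgeCM.CMField.K F))) : (HodgeCM.CMField.K F)) ha ha0).D)
    (compat_plane V Φ ι₁ ((a : ↥(maximalRealSubfield (HodgeCM.CMField.K F))) : (HodgeCM.CMField.K F)) ha ha0) (compat_line₀ V Φ ι₁ ((a : ↥(maximalRealSubfield (HodgeCM.CMField.K F))) : (HodgeCM.CMField.K F)) ha ha0) (compat_line₁ V Φ ι₁ ((a : ↥(maximalRealSubfield (HodgeCM.CMField.K F))) : (HodgeCM.CMField.K F)) ha ha0) ι₁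
    (frameD_sign_ι₁' V) (h₁W_cDiag Φ ι₁ ((a : ↥(maximalRealSubfield (HodgeCM.CMField.K F))) : (HodgeCM.CMField.K F)) ha ha0) (frameD_sign_of_ne V)
  obtain ⟨κ₁, hκ₁⟩ := exists_kappa V (cDiag Φ ι₁ ((a : ↥(maximalRealSubfield (HodgeCM.CMField.K F))) : (HodgeCM.CMField.K F)) ha ha0).D
    (compat_plane V Φ ι₁ ((a : ↥(maximalRealSubfield (HodgeCM.CMField.K F))) : (HodgeCM.CMField.K F)) ha ha0) (compat_line₀ V Φ ι₁ ((a : ↥(maximalRealSubfield (HodgeCM.CMField.K F))) : (HodgeCM.CMField.K F)) ha ha0) (compat_line₁ V Φ ι₁ ((a : ↥(maximalRealSubfield (HodgeCM.CMField.K F))) : (HodgeCM.CMField.K F)) ha ha0)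
    (compat_line₂ V Φ ι₁ ((a : ↥(maximalRealSubfield (HodgeCM.CMField.K F))) : (HodgeCM.CMField.K F)) ha ha0) (compat_line₃ V Φ ι₁ ((a : ↥(maximalRealSubfield (HodgeCM.CMField.K F))) : (HodgeCM.CMField.K F)) ha ha0) _ _ _ _
    ((HodgeCM.Adelic.regimeEquiv F V.Hm hV).symm.trans (cmFrameEquiv (HodgeCM.CMField.K F) (frameG V) V.Hm (frameD V) (frame_congr V))).toMulEquiv
    (fun _ => rfl) (cmLineTorusEquiv (HodgeCM.CMField.K F) ((a : ↥(maximalRealSubfield (HodgeCM.CMField.K F))) : (HodgeCM.CMField.K F)) ha0) (cmLineTorusEquiv_apply (HodgeCM.CMField.K F) ((a : ↥(maximalRealSubfield (HodgeCM.CMField.K F))) : (HodgeCM.CMField.K F)) ha0) _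
    (sideAt_P_ω V Φ ι₁ ((a : ↥(maximalRealSubfield (HodgeCM.CMField.K F))) : (HodgeCM.CMField.K F)) ha ha0 1 (one_apply_rat_eq_one V (cDiag Φ ι₁ ((a : ↥(maximalRealSubfield (HodgeCM.CMField.K F))) : (HodgeCM.CMField.K F)) ha ha0)) (continuous_one_val V (cDiag Φ ι₁ ((a : ↥(maximalRealSubfield (HodgeCM.CMField.K F))) : (HodgeCM.CMField.K F)) ha ha0)) _ hν hνc A 0)
    (ThetaAdelicSide.hΓU _ 0) (cmLineTorusEquiv_mem_CMRat_iff (HodgeCM.CMField.K F) ((a : ↥(maximalRealSubfield (HodgeCM.CMField.K F))) : (HodgeCM.CMField.K F)) ha0)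
    (by
      simp only [Units.val_mul]
      exact (hη₀c.comp (continuous_const.prodMk (continuous_cmAdelicOneEquivRelNormOne_symm (HodgeCM.CMField.K F)))).mul
        (hχ₀c.comp (continuous_const.prodMk (continuous_cmLineTorusEquiv (HodgeCM.CMField.K F) ((a : ↥(maximalRealSubfield (HodgeCM.CMField.K F))) : (HodgeCM.CMField.K F)) ha0))))
  -- the trivial splitting ratio: `splittingOf hGR₀ = splittingOf hGR₀ ⊗ 1`, `κ₂ = 1`
  have hκ₂ : ∀ h : CMAdelic (F : Type) (lineVec (F : Type) ((a : ↥(maximalRealSubfield (HodgeCM.CMField.K F))) : (HodgeCM.CMField.K F))),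
      (1 : C(CMAdelic (F : Type) (lineVec (F : Type) ((a : ↥(maximalRealSubfield (HodgeCM.CMField.K F))) : (HodgeCM.CMField.K F))) ⧸ CMRat (F : Type) (lineVec (F : Type) ((a : ↥(maximalRealSubfield (HodgeCM.CMField.K F))) : (HodgeCM.CMField.K F))), ℂ)) (QuotientGroup.mk h) =
        (((1 : ↥(UnitaryGroup.adelicPair (↥(maximalRealSubfield (HodgeCM.CMField.K F))) (HodgeCM.CMField.K F) (IsCMField.complexConj (HodgeCM.CMField.K F)) 3 1
            (Matrix.diagonal (frameD V)) (Matrix.diagonal (lineVec (HodgeCM.CMField.K F) ((a : ↥(maximalRealSubfield (HodgeCM.CMField.K F))) : (HodgeCM.CMField.K F))))) →* ℂˣ)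
          (UnitaryGroup.adelicInr (↥(maximalRealSubfield (HodgeCM.CMField.K F))) (HodgeCM.CMField.K F) (IsCMField.complexConj (HodgeCM.CMField.K F)) 3 1
            (Matrix.diagonal (frameD V)) (Matrix.diagonal (lineVec (HodgeCM.CMField.K F) ((a : ↥(maximalRealSubfield (HodgeCM.CMField.K F))) : (HodgeCM.CMField.K F)))) h) : ℂˣ) : ℂ) := fun _ => by
    rw [ContinuousMap.one_apply, MonoidHom.one_apply, Units.val_one]
  -- the line instances in the `dW (cDiag …).D 0` spelling of ★ p798140 (definitionally the ones above)
  haveI hnormal' : (CMRat (F : Type) (lineVec (F : Type) (dW (cDiag Φ ι₁ ((a : ↥(maximalRealSubfield (HodgeCM.CMField.K F))) : (HodgeCM.CMField.K F)) ha ha0).D 0))).Normal := hnormal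
  letI mWq' : MeasurableSpace (CMAdelic (F : Type) (lineVec (F : Type) (dW (cDiag Φ ι₁ ((a : ↥(maximalRealSubfield (HodgeCM.CMField.K F))) : (HodgeCM.CMField.K F)) ha ha0).D 0)) ⧸
      CMRat (F : Type) (lineVec (F : Type) (dW (cDiag Φ ι₁ ((a : ↥(maximalRealSubfield (HodgeCM.CMField.K F))) : (HodgeCM.CMField.K F)) ha ha0).D 0))) := mWq
  haveI : BorelSpace (CMAdelic (F : Type) (lineVec (F : Type) (dW (cDiag Φ ι₁ ((a : ↥(maximalRealSubfield (HodgeCM.CMField.K F))) : (HodgeCM.CMField.K F)) ha ha0).D 0)) ⧸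
      CMRat (F : Type) (lineVec (F : Type) (dW (cDiag Φ ι₁ ((a : ↥(maximalRealSubfield (HodgeCM.CMField.K F))) : (HodgeCM.CMField.K F)) ha ha0).D 0))) := ⟨rfl⟩
  haveI hcW' : CompactSpace (CMAdelic (F : Type) (lineVec (F : Type) (dW (cDiag Φ ι₁ ((a : ↥(maximalRealSubfield (HodgeCM.CMField.K F))) : (HodgeCM.CMField.K F)) ha ha0).D 0)) ⧸
      CMRat (F : Type) (lineVec (F : Type) (dW (cDiag Φ ι₁ ((a : ↥(maximalRealSubfield (HodgeCM.CMField.K F))) : (HodgeCM.CMField.K F)) ha ha0).D 0))) := hcW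
  -- (11) ★ p798140: `χ̃`, `hne` and the `(χ)` row, read off the pin character
  obtain ⟨χM, -, hne, hχrow⟩ := exists_chiRow_and_hne_of_pin_thetaLift_ne_zero V hV (cDiag Φ ι₁ ((a : ↥(maximalRealSubfield (HodgeCM.CMField.K F))) : (HodgeCM.CMField.K F)) ha ha0).D
    (compat_plane V Φ ι₁ ((a : ↥(maximalRealSubfield (HodgeCM.CMField.K F))) : (HodgeCM.CMField.K F)) ha ha0) (compat_line₀ V Φ ι₁ ((a : ↥(maximalRealSubfield (HodgeCM.CMField.K F))) : (HodgeCM.CMField.K F)) ha ha0) (compat_line₁ V Φ ι₁ ((a : ↥(maximalRealSubfield (HodgeCM.CMField.K F))) : (HodgeCM.CMField.K F)) ha ha0)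
    (compat_line₂ V Φ ι₁ ((a : ↥(maximalRealSubfield (HodgeCM.CMField.K F))) : (HodgeCM.CMField.K F)) ha ha0) (compat_line₃ V Φ ι₁ ((a : ↥(maximalRealSubfield (HodgeCM.CMField.K F))) : (HodgeCM.CMField.K F)) ha ha0) _ _ _ _ _
    (sideAt_P_ω V Φ ι₁ ((a : ↥(maximalRealSubfield (HodgeCM.CMField.K F))) : (HodgeCM.CMField.K F)) ha ha0 1 (one_apply_rat_eq_one V (cDiag Φ ι₁ ((a : ↥(maximalRealSubfield (HodgeCM.CMField.K F))) : (HodgeCM.CMField.K F)) ha ha0)) (continuous_one_val V (cDiag Φ ι₁ ((a : ↥(maximalRealSubfield (HodgeCM.CMField.K F))) : (HodgeCM.CMField.K F)) ha ha0)) _ hν hνc A 0)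
    (distDatumAt V Φ ι₁ ((a : ↥(maximalRealSubfield (HodgeCM.CMField.K F))) : (HodgeCM.CMField.K F)) ha ha0 1 (one_apply_rat_eq_one V (cDiag Φ ι₁ ((a : ↥(maximalRealSubfield (HodgeCM.CMField.K F))) : (HodgeCM.CMField.K F)) ha ha0)) (continuous_one_val V (cDiag Φ ι₁ ((a : ↥(maximalRealSubfield (HodgeCM.CMField.K F))) : (HodgeCM.CMField.K F)) ha ha0)) _ hν hνc A hV _ harm hdef)
    κ₁ hκ₁ 1 1 hκ₂ χ₂ hρ₀ Set.univ hSK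
    (splittingOf_isCompatible _ _ _ _ _ _ _ _ _ _ _ _ _ _ _ _ _ (compat_line₀ V Φ ι₁ ((a : ↥(maximalRealSubfield (HodgeCM.CMField.K F))) : (HodgeCM.CMField.K F)) ha ha0))
    (adelicMpCont.twist_one _).symm hρ₀ Set.univ hSK (fun u => u) (fun _ => rfl) hlift
  refine ⟨χM, fun u => ?_, hne⟩
  rw [hχrow u]
  congr 1
  refine Units.ext ?_
  rw [Units.val_mul, MonoidHom.one_apply, Units.val_one, one_mul, Circle.toUnits_apply, Units.val_mk0]
  refine (hχ₂ _).trans ?_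
  erw [UnitaryGroup.finPart_finAdelicToAdelic, MonoidHom.mul_apply, MonoidHom.inv_apply, comp_pairEmbFin_apply_inr _ _ _ _ _ _ _ ĉ u]
  rfl

end Summit.HodgeConjecture.HodgeConjecture.Cruxes.H413.ThetaJunction

end
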